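import Summits.Schanuel.Schanuel.Theorems.RootDecomp1KXLinear01

/-!
# RootDecomp1KXLinear — lens 1, generation 45, node 2 (g45b) «X-LINEAR THIN FIBRE: ALL CURVES A(Y) + x·B(Y) WITH deg B < deg A, HYPOTHESIS-FREE» (RULE K-R31 (ii) second clause + K-R32 (i); CLAIM L2261, ACK/CHECKLIST K-g45b L2262, NODE L2274 / REQUEST L2275, critic VERDICT L2278: CLEARED — THEOREM ×2; port shape L2282 (d)) — continuation (RootDecomp1KXLinear02): §X part 1 — xLinP, level points, Steps 1a/1b/2/6, 2-adic infrastructure (i)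

(lens-1 g45b HOME kernel K₂ = HOME/decomp-schanuel-lens-1/g45b/DLxlinear.lean db54a0a5…, 3838 l = the DegreeLadder ed. 3 prefix (tree: RootDecomp1KDegreeLadder01–09) + `XLinearCore` (l.2184–2562) + §X (l.2564–3836); imports SkelCell01 + Literature RidoutIntegers (BUILT on the farm since 20:13Z). Port by census-1 gen 19 as `RootDecomp1KXLinear01`–`05`: 01 = XLinearCore (namespace `…RootDecomp1KXLinearCore`; the 2-adic CORE LEMMA `core` — second-order approximation of the nearest e-th root by the rationally shifted point — `roots_structure`, and Step 5 `ridout_step` with `Ridout.padicRoth_int` BY TREE NAME; imports tree DegreeLadder08 + Literature RidoutIntegers); 02–05 = §X (namespace `…RootDecomp1KXLinear`): 02 = `xLinP`, `gap`, level points `OnLevel`, Steps 1a/1b/2/6, 2-adic infrastructure (first half); 03 = 2-adic infrastructure (second half: the shifted integer, valuation bookkeeping); 04 = the composition `levels_finite` → `thinFibreAt_xLinP` (scoped `maxHeartbeats 800000` ×2 as in K) + common rational roots; 05 = pole gap e = 1 `thinFibreAt_xLinP_gapOne` (no Ridout), `thinFibreAt_xLinear`, `thinFibreAt_xLinear_of_lt`,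 the typed classes `XLinearGap2` / `XLinearLt` with `thinFibreAt_of_xLinearGap2` / `thinFibreAt_of_xLinearLt` / `thinFibreAt_sqMulP'` (all c ≠ 0), positions and non-members (`not_xLinearGap2_lineP`, `cuspP`), the consumer `xLinear_nonvanishing (hm : 2 ≤ m) (hρ : SkelLiouvilleFix m ρ) (A B) (hB : B ≠ 0) (hlt : B.natDegree < A.natDegree) : aeval ρ A + liouvilleNumber 2 * aeval ρ B ≠ 0` — ALL HYPOTHESIS-FREE.
PORT EDITS (critic L2282 (d)): the DegreeLadder prefix dropped (tree parts imported); the `(hR : PadicRothInt)` binder REMOVED from the ten decls that carried it and `Literature.NumberTheory.DiophantineApproximation.Ridout.padicRoth_int` fed directly at the one use site in `ridout_step`; the §HypFree primed twins and `padicRothInt_holds` DROPPED (the unprimed names now denote the binder-free forms); `open …DegreeLadder (PadicRothInt pTwo)` ↦ `(pTwo)`; two linter options dropped; 22 one-line docstrings added; seven generic p-adic/arithmetic helpers private (`norm_natCast_le_one`, `norm_two`, `norm_two_pow`, `norm_intCast_le_one'`, `factorial_sub_ge`, `natDegree_linear`, `den_dvd_leadingCoeff` — dedup-safety vs DegreeLadder08's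 private 2-adic lemmas) with per-part private copies, plus private copies of the DegreeLadder port's private ℓ₂/psNumer lemmas where §X uses them; statements and proofs otherwise verbatim. `--supports stmt-Schanuel-33364`; no census credit carried; rung 0 — nothing here proves Schanuel; `ThinFibre m₀` (all curves) stays OPEN / IDEA-NEEDED.)
-/

noncomputable section

namespace Summit.Schanuel.Schanuel.Theorems.RootDecomp1KXLinear

open Polynomial LiouvilleNumber
open scoped Nat
open Summit.Schanuel.Schanuel.Theorems.RootDecomp1KSkelCell
  (exists_le_two_pow_factorial iota iota_spec iota_le_of_le pow_lt_of_lt_iota lt_iota_of_pow_lt iota_mono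
   one_le_iota SkelLiouville SkelLiouvilleFix skelLiouville_iff_fix SkelLiouvilleFix.mono uStar dU rU dU_cast
   two_pow_le_four_mul_dU two_mul_dU_lt one_le_dU rU_den rU_cast uStar_sub_rU skelLiouvilleFix_one_uStar
   not_skelFixOne_algebraicIndependent)
open Summit.Schanuel.Schanuel.Theorems.RootDecomp1KTwoBaseCell (psNumer partialSum_eq_psNumer_div coprime_psNumer
  algebraicIndependent_of_forall_int')
open Summit.Schanuel.Schanuel.Theorems.RootDecomp1KRelLiouvilleCell (partialSum_two_strictMono
  partialSum_two_lt_liouvilleNumber abs_liouvilleNumber_two_sub_partialSum)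
open Summit.Schanuel.Schanuel.Theorems.RootDecomp1KDegreeLadder
open Summit.Schanuel.Schanuel.Theorems.RootDecomp1KXLinearCore (core ridout_step)

/-- `s_N = p_N / 2^{N!}` (tree `partialSum_eq_psNumer_div` at `b = 2`). -/
private theorem partialSum_two (N : ℕ) : partialSum 2 N = (psNumer 2 N : ℝ) / (2 : ℝ) ^ N ! := by
  have := partialSum_eq_psNumer_div (b := 2) (by norm_num) N
  simpa using this

/-- `|m|₂ = 2^{−v₂(m)}` for a non-zero integer `m`, in `\overline{ℚ₂}` (the norm of `PadicAlgCl 2` extends that of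
`ℚ_[2]`; cf. `Literature.NumberTheory.DiophantineApproximation.norm_intCast_padicAlgCl`). -/
private theorem norm_intCast_padicAlgCl_two {m : ℤ} (hm : m ≠ 0) :
    ‖(m : PadicAlgCl 2)‖ = (2 : ℝ) ^ (-(padicValInt 2 m : ℤ)) := by
  have h1 : (m : PadicAlgCl 2) = algebraMap ℚ_[2] (PadicAlgCl 2) (m : ℚ_[2]) := (map_intCast _ m).symm
  rw [h1, PadicAlgCl.norm_extends, Padic.norm_eq_zpow_neg_valuation (by exact_mod_cast hm),
    Padic.valuation_intCast]
  norm_num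

/-- `p_M` is odd for `M ≥ 2`. -/
private theorem psNumer_two_odd {M : ℕ} (hM : 2 ≤ M) : Odd (psNumer 2 M) := by
  have h := coprime_psNumer_two_pow hM 1
  rw [pow_one] at h
  have h2 : ¬ 2 ∣ psNumer 2 M := (Nat.Prime.coprime_iff_not_dvd Nat.prime_two).mp h
  exact Nat.odd_iff.mpr (Nat.two_dvd_ne_zero.mp h2)

/-- `|m|₂ = 1` for an odd integer `m`, in `\overline{ℚ₂}`. -/
private theorem norm_intCast_of_odd {m : ℤ} (hm : Odd m) : ‖(m : PadicAlgCl 2)‖ = 1 := by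
  have hm0 : m ≠ 0 := by rintro rfl; exact (Int.not_even_iff_odd.mpr hm) ⟨0, rfl⟩
  rw [norm_intCast_padicAlgCl_two hm0]
  have h2 : ¬ ((2 : ℕ) : ℤ) ∣ m := by
    intro h
    exact (Int.not_even_iff_odd.mpr hm) (even_iff_two_dvd.mpr (by exact_mod_cast h))
  rw [padicValInt.eq_zero_of_not_dvd h2]
  simp

/-- `‖2‖₂ = 1/2` in `PadicAlgCl 2`. -/
private theorem norm_two : ‖(2 : PadicAlgCl 2)‖ = 1 / 2 := by
  have h1 : ((2 : ℕ) : PadicAlgCl 2) = algebraMap ℚ_[2] (PadicAlgCl 2) ((2 : ℕ) : ℚ_[2]) :=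
    (map_natCast _ 2).symm
  have h2 : ‖((2 : ℕ) : ℚ_[2])‖ = (↑(2 : ℕ) : ℝ)⁻¹ := Padic.norm_p
  have h3 : ‖((2 : ℕ) : PadicAlgCl 2)‖ = 1 / 2 := by rw [h1, PadicAlgCl.norm_extends, h2]; norm_num
  simpa using h3

/-! # §X — the x-LINEAR thin fibre `ThinFibreAt m₀ (A(Y) + x·B(Y))` (lens-1 g45, node 2)

Blueprint STANDING-RECORD-lens1 §8.  Steps 3–5 are the sorry-free `RootDecomp1KXLinearCore.core` / `.ridout_step`
above; this section sets up the curve-specific data, PROVES Steps 1a/1b/2/6 and the composition `levels_finite` →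
`thinFibreAt_xLinP` (sorry-free; HYPOTHESIS-FREE at port: Ridout by tree name). -/

/-- `A(Y) + x·B(Y)` as an element of `ℤ[x][Y]` (outer variable `Y`, coefficients in `ℤ[x]`). -/
def xLinP (A B : ℤ[X]) : ℤ[X][X] := Polynomial.map C A + C X * Polynomial.map C B

/-- `bev` of a `Y`-polynomial with constant coefficients is its evaluation at `y`. -/
theorem bev_map_C (A : ℤ[X]) (x y : ℝ) : bev (Polynomial.map C A) x y = aeval y A := by
  unfold bev
  rw [Polynomial.map_map]
  have h : ((aeval x : ℤ[X] →ₐ[ℤ] ℝ).toRingHom).comp C = algebraMap ℤ ℝ := by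
    ext
    simp
  rw [h, aeval_def, eval_map]

/-- `xLinP A B (x, y) = A(y) + x·B(y)`. -/
@[simp] theorem bev_xLinP (A B : ℤ[X]) (x y : ℝ) : bev (xLinP A B) x y = aeval y A + x * aeval y B := by
  simp [xLinP, bev_map_C]

/-- `e = deg A − deg B`, the slope denominator of the branch at `x = ∞`. -/
def gap (A B : ℤ[X]) : ℕ := A.natDegree - B.natDegree
/-- `κ = v₂(lc A) − v₂(lc B)`; large-denominator points at level `N` have `e·v₂(den) = N! + κ`. -/
def kap (A B : ℤ[X]) : ℤ := (padicValInt 2 A.leadingCoeff : ℤ) - padicValInt 2 B.leadingCoeff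
/-- threshold `T₀ = max(v₂ lc A, v₂ lc B)` for the valuation bookkeeping. -/
def tee0 (A B : ℤ[X]) : ℕ := max (padicValInt 2 A.leadingCoeff) (padicValInt 2 B.leadingCoeff)
/-- `γ = −2^κ·lc B / lc A`, a 2-adic unit; the branch is `u^e → γ`. -/
def gam (A B : ℤ[X]) : ℚ := -((2 : ℚ) ^ kap A B * B.leadingCoeff / A.leadingCoeff)
/-- `c₁ =` the second coefficient of `A`. -/
def cee1 (A : ℤ[X]) : ℚ := A.coeff (A.natDegree - 1)
/-- `c₂ = 2^κ ·` the second coefficient of `Y·B(Y)` (`= B.coeff (deg B − 1)`, or `0` when `deg B = 0`). -/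
def cee2 (A B : ℤ[X]) : ℚ := (2 : ℚ) ^ kap A B * ((X * B).coeff B.natDegree : ℤ)
/-- the RATIONAL SHIFT `θ = (c₁γ + c₂)/(lc A · e · γ)`. -/
def theta (A B : ℤ[X]) : ℚ := (cee1 A * gam A B + cee2 A B) / (A.leadingCoeff * gap A B * gam A B)

/-- [auxiliary predicate] the level-`N` point equation in `ℚ`: `A(r) + s_N·B(r) = 0` (definition with parameters, not a fact). -/
def OnLevel (A B : ℤ[X]) (N : ℕ) (r : ℚ) : Prop :=
  aeval r A + (psNumer 2 N : ℚ) / 2 ^ N ! * aeval r B = 0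

/-- Casting a rational evaluation of an integer polynomial into a characteristic-zero division ring. -/
theorem aeval_ratCast {L : Type*} [DivisionRing L] [CharZero L] (A : ℤ[X]) (r : ℚ) :
    ((aeval r A : ℚ) : L) = aeval (r : L) A := by
  rw [aeval_def, aeval_def,
    show ((eval₂ (algebraMap ℤ ℚ) r A : ℚ) : L) = (Rat.castHom L) (eval₂ (algebraMap ℤ ℚ) r A) from rfl,
    hom_eval₂]
  congr 1
  exact RingHom.ext_int _ _

/-- A zero of `xLinP A B` at the truncation `x = s_N` is a level-`N` point. -/
theorem onLevel_of_bev {A B : ℤ[X]} {N : ℕ} {r : ℚ} (h : bev (xLinP A B) (partialSum 2 N) r = 0) :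
    OnLevel A B N r := by
  unfold OnLevel
  have hA : aeval (r : ℝ) A = ((aeval r A : ℚ) : ℝ) := (aeval_ratCast A r).symm
  have hB : aeval (r : ℝ) B = ((aeval r B : ℚ) : ℝ) := (aeval_ratCast B r).symm
  rw [bev_xLinP, partialSum_two, hA, hB] at h
  have h' : ((aeval r A + (psNumer 2 N : ℚ) / 2 ^ N ! * aeval r B : ℚ) : ℝ) = 0 := by
    push_cast
    linarith
  exact_mod_cast h'

/-! ### Steps 1a, 1b, 2, 6 of the blueprint (all PROVED) -/

/-- `‖(z : \overline{ℚ₂})‖ ≤ 1` for integers. -/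
private theorem norm_intCast_le_one' (z : ℤ) : ‖(z : PadicAlgCl 2)‖ ≤ 1 := by
  have h1 : (z : PadicAlgCl 2) = algebraMap ℚ_[2] (PadicAlgCl 2) (z : ℚ_[2]) := (map_intCast _ z).symm
  rw [h1, PadicAlgCl.norm_extends]
  exact Padic.norm_int_le_one z

/-- `‖γ‖₂ = 1` (this is what the exponent `κ` is for). -/
theorem norm_gam (A B : ℤ[X]) (hA : A.leadingCoeff ≠ 0) (hB : B.leadingCoeff ≠ 0) :
    ‖(gam A B : PadicAlgCl 2)‖ = 1 := by
  have ha := norm_intCast_padicAlgCl_two hA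
  have hb := norm_intCast_padicAlgCl_two hB
  unfold gam kap
  push_cast
  rw [norm_neg, norm_div, norm_mul, norm_zpow, norm_two, ha, hb, one_div, inv_zpow', ← zpow_add₀ two_ne_zero,
    div_eq_one_iff_eq (zpow_ne_zero _ two_ne_zero)]
  congr 1
  ring

/-- the integer polynomial `2^{N!}·A + p_N·B` of which a level-`N` point is a root -/
theorem onLevel_root {A B : ℤ[X]} {N : ℕ} {r : ℚ} (hpt : OnLevel A B N r) :
    aeval r (C ((2 : ℤ) ^ N !) * A + C (psNumer 2 N : ℤ) * B) = 0 := by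
  unfold OnLevel at hpt
  have h2 : (2 : ℚ) ^ N ! ≠ 0 := by positivity
  simp only [map_add, map_mul, aeval_C, algebraMap_int_eq, Int.coe_castRingHom, Int.cast_pow, Int.cast_ofNat,
    Int.cast_natCast]
  field_simp at hpt
  linarith [hpt]

/-- Gauss: the reduced denominator of a rational root divides the leading coefficient. -/
private theorem den_dvd_leadingCoeff (P : ℤ[X]) (r : ℚ) (hr : aeval r P = 0) : (r.den : ℤ) ∣ P.leadingCoeff := by
  have h1 := den_dvd_of_is_root (A := ℤ) (K := ℚ) hr
  have h2 : (algebraMap ℤ ℚ (IsFractionRing.num ℤ r)) / (algebraMap ℤ ℚ (IsFractionRing.den ℤ r : ℤ)) = r := by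
    rw [← IsFractionRing.mk'_eq_div]; exact IsFractionRing.mk'_num_den ℤ r
  have h3 : (r.den : ℤ) ∣ (IsFractionRing.den ℤ r : ℤ) := by
    have e : r = Rat.divInt (IsFractionRing.num ℤ r) (IsFractionRing.den ℤ r : ℤ) := by
      rw [Rat.divInt_eq_div]; simpa using h2.symm
    conv_lhs => rw [e]
    exact Rat.den_dvd _ _
  exact h3.trans h1

/-- **Step 1a** (denominators): `den r = 2^t·q′` with `q′ ∣ lc A`. -/
theorem den_dvd_lc_two_pow (A B : ℤ[X]) (hAB : B.natDegree < A.natDegree) {N : ℕ} {r : ℚ}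
    (hpt : OnLevel A B N r) :
    (r.den : ℤ) ∣ A.leadingCoeff * 2 ^ padicValNat 2 r.den := by
  have hA0 : A ≠ 0 := by rintro rfl; simp at hAB
  -- leading coefficient of `2^{N!} A + p_N B`
  set P : ℤ[X] := C ((2 : ℤ) ^ N !) * A + C (psNumer 2 N : ℤ) * B with hP
  have hdegA : (C ((2 : ℤ) ^ N !) * A).natDegree = A.natDegree := natDegree_C_mul (pow_ne_zero _ two_ne_zero)
  have hdegB : (C (psNumer 2 N : ℤ) * B).natDegree < A.natDegree :=
    lt_of_le_of_lt (natDegree_C_mul_le _ _) hAB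
  have hlc : P.leadingCoeff = 2 ^ N ! * A.leadingCoeff := by
    rw [hP, leadingCoeff_add_of_degree_lt' (degree_lt_degree (by rw [hdegA]; exact hdegB)), leadingCoeff_mul,
      leadingCoeff_C]
  have hroot : aeval r P = 0 := onLevel_root hpt
  have h1 : (r.den : ℤ) ∣ 2 ^ N ! * A.leadingCoeff := hlc ▸ den_dvd_leadingCoeff P r hroot
  -- split `den = 2^t · q'` with `q'` odd
  set t := padicValNat 2 r.den with ht
  obtain ⟨q', hq'⟩ : 2 ^ t ∣ r.den := pow_padicValNat_dvd
  have hq'odd : ¬ 2 ∣ q' := by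
    intro h2
    have : 2 ^ (t + 1) ∣ r.den := by rw [hq', pow_succ]; exact Nat.mul_dvd_mul_left _ h2
    exact absurd this (pow_succ_padicValNat_not_dvd r.den_nz)
  -- `q' ∣ 2^{N!} a` and `q'` odd ⇒ `q' ∣ a`
  have hqd : (q' : ℤ) ∣ (r.den : ℤ) := ⟨2 ^ t, by rw [hq']; push_cast; ring⟩
  have h2 : (q' : ℤ) ∣ 2 ^ N ! * A.leadingCoeff := hqd.trans h1
  have hcop : IsCoprime (q' : ℤ) ((2 : ℤ) ^ N !) := by
    apply IsCoprime.pow_right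
    rw [Int.isCoprime_iff_gcd_eq_one, show ((q' : ℤ)).gcd 2 = Nat.gcd q' 2 from Int.gcd_natCast_natCast q' 2]
    exact ((Nat.Prime.coprime_iff_not_dvd Nat.prime_two).mpr hq'odd).symm
  have h3 : (q' : ℤ) ∣ A.leadingCoeff := hcop.dvd_of_dvd_mul_left h2
  rw [hq']
  push_cast
  rw [mul_comm (A.leadingCoeff)]
  exact mul_dvd_mul_left _ h3

/-! #### 2-adic infrastructure -/

/-- `|r|₂ = 2^{-v₂(r)}` in `\overline{ℚ₂}`. -/
theorem norm_ratCast_two {r : ℚ} (hr : r ≠ 0) : ‖(r : PadicAlgCl 2)‖ = (2 : ℝ) ^ (-padicValRat 2 r) := by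
  have h1 : (r : PadicAlgCl 2) = algebraMap ℚ_[2] (PadicAlgCl 2) (r : ℚ_[2]) := (map_ratCast _ r).symm
  rw [h1, PadicAlgCl.norm_extends, Padic.eq_padicNorm, padicNorm.eq_zpow_of_nonzero hr]
  push_cast
  rfl

/-- a rational with EVEN denominator `2^t·q′` has `|r|₂ = 2^t`. -/
theorem norm_ratCast_of_le {r : ℚ} (ht : 1 ≤ padicValNat 2 r.den) :
    ‖(r : PadicAlgCl 2)‖ = (2 : ℝ) ^ padicValNat 2 r.den := by
  have h2den : 2 ∣ r.den := dvd_of_one_le_padicValNat ht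
  have hr : r ≠ 0 := by
    rintro rfl
    simp at h2den
  have hnum : ¬ (2 : ℤ) ∣ r.num := by
    intro h
    have h' : 2 ∣ r.num.natAbs := Int.ofNat_dvd_left.mp h
    have := Nat.Coprime.eq_one_of_dvd (Nat.Coprime.coprime_dvd_left h' r.reduced) h2den
    norm_num at this
  rw [norm_ratCast_two hr, padicValRat_def, padicValInt.eq_zero_of_not_dvd hnum]
  simp

/-- `2^{tn}·H(r) = Σ_{i ≤ n} H_i u^i 2^{t(n−i)}` with `u = 2^t r`. -/
theorem expand_eq (H : ℤ[X]) {n : ℕ} (hn : H.natDegree ≤ n) (r : PadicAlgCl 2) (t : ℕ) :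
    (2 : PadicAlgCl 2) ^ (t * n) * aeval r H =
      ∑ i ∈ Finset.range (n + 1), (H.coeff i : PadicAlgCl 2) * ((2 : PadicAlgCl 2) ^ t * r) ^ i *
        (2 : PadicAlgCl 2) ^ (t * (n - i)) := by
  rw [aeval_eq_sum_range' (lt_of_le_of_lt hn (Nat.lt_succ_self n)), Finset.mul_sum]
  refine Finset.sum_congr rfl fun i hi => ?_
  have hi' : i ≤ n := Nat.lt_succ_iff.mp (Finset.mem_range.mp hi)
  have hsplit : t * n = t * i + t * (n - i) := by
    rw [← Nat.mul_add]; congr 1; omega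
  rw [zsmul_eq_mul, mul_pow, hsplit, pow_add]
  ring

/-- two-term truncation: `‖Σ_{i≤n} H_i u^i 2^{t(n−i)} − (H_n u^n + 2^t H_{n−1} u^{n−1})‖ ≤ 4^{−t}` (`n ≥ 1`, `|u| ≤ 1`). -/
theorem approx_two (H : ℤ[X]) {n : ℕ} (hn : 1 ≤ n) (u : PadicAlgCl 2) (hu : ‖u‖ ≤ 1) (t : ℕ) :
    ‖∑ i ∈ Finset.range (n + 1), (H.coeff i : PadicAlgCl 2) * u ^ i * (2 : PadicAlgCl 2) ^ (t * (n - i)) -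
      ((H.coeff n : PadicAlgCl 2) * u ^ n + (2 : PadicAlgCl 2) ^ t * (H.coeff (n - 1) : PadicAlgCl 2) * u ^ (n - 1))‖
      ≤ (1 / 4 : ℝ) ^ t := by
  obtain ⟨k, rfl⟩ : ∃ k, n = k + 1 := ⟨n - 1, by omega⟩
  rw [Finset.sum_range_succ, Finset.sum_range_succ]
  simp only [Nat.add_sub_cancel, Nat.sub_self, mul_zero, pow_zero, mul_one,
    show k + 1 - k = 1 from by omega]
  have hrw : ∑ i ∈ Finset.range k, (H.coeff i : PadicAlgCl 2) * u ^ i * (2 : PadicAlgCl 2) ^ (t * (k + 1 - i)) +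
      (H.coeff k : PadicAlgCl 2) * u ^ k * 2 ^ t + (H.coeff (k + 1) : PadicAlgCl 2) * u ^ (k + 1) -
      ((H.coeff (k + 1) : PadicAlgCl 2) * u ^ (k + 1) + 2 ^ t * (H.coeff k : PadicAlgCl 2) * u ^ k) =
      ∑ i ∈ Finset.range k, (H.coeff i : PadicAlgCl 2) * u ^ i * (2 : PadicAlgCl 2) ^ (t * (k + 1 - i)) := by
    ring
  rw [hrw]
  apply IsUltrametricDist.norm_sum_le_of_forall_le_of_nonneg (by positivity)
  intro i hi
  have hi' : i < k := Finset.mem_range.mp hi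
  rw [norm_mul, norm_mul, norm_pow, norm_pow, norm_two]
  have h1 : ‖(H.coeff i : PadicAlgCl 2)‖ ≤ 1 := norm_intCast_le_one' _
  have h2 : ‖u‖ ^ i ≤ 1 := pow_le_one₀ (norm_nonneg _) hu
  have h3 : (1 / 2 : ℝ) ^ (t * (k + 1 - i)) ≤ (1 / 4 : ℝ) ^ t := by
    have : (1 / 4 : ℝ) ^ t = (1 / 2 : ℝ) ^ (t * 2) := by
      rw [mul_comm, pow_mul]; norm_num
    rw [this]
    exact pow_le_pow_of_le_one (by norm_num) (by norm_num) (Nat.mul_le_mul_left t (by omega))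
  calc ‖(H.coeff i : PadicAlgCl 2)‖ * ‖u‖ ^ i * (1 / 2 : ℝ) ^ (t * (k + 1 - i))
      ≤ 1 * 1 * (1 / 4 : ℝ) ^ t := by gcongr
    _ = (1 / 4 : ℝ) ^ t := by ring

/-- one-term truncation: `‖Σ_{i≤n} H_i u^i 2^{t(n−i)} − H_n u^n‖ ≤ 2^{−t}` (`|u| ≤ 1`). -/
theorem approx_one (H : ℤ[X]) (n : ℕ) (u : PadicAlgCl 2) (hu : ‖u‖ ≤ 1) (t : ℕ) :
    ‖∑ i ∈ Finset.range (n + 1), (H.coeff i : PadicAlgCl 2) * u ^ i * (2 : PadicAlgCl 2) ^ (t * (n - i)) -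
      (H.coeff n : PadicAlgCl 2) * u ^ n‖ ≤ (1 / 2 : ℝ) ^ t := by
  rw [Finset.sum_range_succ]
  simp only [Nat.sub_self, mul_zero, pow_zero, mul_one, add_sub_cancel_right]
  apply IsUltrametricDist.norm_sum_le_of_forall_le_of_nonneg (by positivity)
  intro i hi
  have hi' : i < n := Finset.mem_range.mp hi
  rw [norm_mul, norm_mul, norm_pow, norm_pow, norm_two]
  have h1 : ‖(H.coeff i : PadicAlgCl 2)‖ ≤ 1 := norm_intCast_le_one' _
  have h2 : ‖u‖ ^ i ≤ 1 := pow_le_one₀ (norm_nonneg _) hu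
  have h3 : (1 / 2 : ℝ) ^ (t * (n - i)) ≤ (1 / 2 : ℝ) ^ t := by
    exact pow_le_pow_of_le_one (by norm_num) (by norm_num) (Nat.le_mul_of_pos_right t (by omega))
  calc ‖(H.coeff i : PadicAlgCl 2)‖ * ‖u‖ ^ i * (1 / 2 : ℝ) ^ (t * (n - i))
      ≤ 1 * 1 * (1 / 2 : ℝ) ^ t := by gcongr
    _ = (1 / 2 : ℝ) ^ t := by ring

/-- the dominant-term valuation: for `t = v₂(den r) > v₂(lc H)`, `‖2^{t·deg H}·H(r)‖₂ = ‖lc H‖₂`. -/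
theorem norm_scaled_eval (H : ℤ[X]) (hH : H ≠ 0) {r : ℚ} (ht1 : 1 ≤ padicValNat 2 r.den)
    (ht : padicValInt 2 H.leadingCoeff < padicValNat 2 r.den) :
    ‖(2 : PadicAlgCl 2) ^ (padicValNat 2 r.den * H.natDegree) * aeval (r : PadicAlgCl 2) H‖ =
      ‖(H.leadingCoeff : PadicAlgCl 2)‖ := by
  set t := padicValNat 2 r.den with ht_def
  set u : PadicAlgCl 2 := (2 : PadicAlgCl 2) ^ t * r with hu_def
  have hu : ‖u‖ = 1 := by
    rw [hu_def, norm_mul, norm_pow, norm_two, norm_ratCast_of_le ht1, ← ht_def, ← mul_pow]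
    norm_num
  rw [expand_eq H le_rfl (r : PadicAlgCl 2) t]
  have happ := approx_one H H.natDegree u hu.le t
  have hlc : ‖(H.leadingCoeff : PadicAlgCl 2) * u ^ H.natDegree‖ = ‖(H.leadingCoeff : PadicAlgCl 2)‖ := by
    rw [norm_mul, norm_pow, hu, one_pow, mul_one]
  have hlcv : ‖(H.leadingCoeff : PadicAlgCl 2)‖ = (2 : ℝ) ^ (-(padicValInt 2 H.leadingCoeff : ℤ)) :=
    norm_intCast_padicAlgCl_two (leadingCoeff_ne_zero.mpr hH)
  have hlt : (1 / 2 : ℝ) ^ t < ‖(H.leadingCoeff : PadicAlgCl 2)‖ := by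
    rw [hlcv, one_div, inv_pow, ← zpow_natCast, ← zpow_neg]
    exact zpow_lt_zpow_right₀ (by norm_num) (by omega)
  -- `S = lc·u^n + (S − lc·u^n)` with the second term strictly smaller
  set S := ∑ i ∈ Finset.range (H.natDegree + 1), (H.coeff i : PadicAlgCl 2) * u ^ i *
    (2 : PadicAlgCl 2) ^ (t * (H.natDegree - i)) with hS
  have hsmall : ‖S - (H.leadingCoeff : PadicAlgCl 2) * u ^ H.natDegree‖ <
      ‖(H.leadingCoeff : PadicAlgCl 2) * u ^ H.natDegree‖ := by
    rw [hlc]; exact lt_of_le_of_lt happ hlt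
  have := IsUltrametricDist.norm_add_eq_max_of_norm_ne_norm (ne_of_gt hsmall)
  rw [add_sub_cancel, max_eq_left hsmall.le] at this
  rw [this, hlc]

/-- **Step 1b** (valuations): for `t = v₂(den r) > T₀`, `e·t = N! + κ`. -/
theorem val_relation (A B : ℤ[X]) (hAB : B.natDegree < A.natDegree) {N : ℕ} (hN : 2 ≤ N) {r : ℚ}
    (hpt : OnLevel A B N r) (hAr : aeval r A ≠ 0) (hBr : aeval r B ≠ 0)
    (ht : tee0 A B < padicValNat 2 r.den) :
    ((gap A B * padicValNat 2 r.den : ℕ) : ℤ) = (N ! : ℕ) + kap A B := by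
  have hA0 : A ≠ 0 := by rintro rfl; simp at hAB
  have hB0 : B ≠ 0 := by rintro rfl; simp at hBr
  have ha : A.leadingCoeff ≠ 0 := leadingCoeff_ne_zero.mpr hA0
  have hb : B.leadingCoeff ≠ 0 := leadingCoeff_ne_zero.mpr hB0
  set t := padicValNat 2 r.den with ht_def
  have hta : padicValInt 2 A.leadingCoeff < t := lt_of_le_of_lt (le_max_left _ _) ht
  have htb : padicValInt 2 B.leadingCoeff < t := lt_of_le_of_lt (le_max_right _ _) ht
  have ht1 : 1 ≤ t := by omega
  -- the identity `2^{N!}·(2^{ta}A(r)) = -p · 2^{te} · (2^{tb}B(r))` in `\overline{ℚ₂}`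
  have hK : (aeval (r : PadicAlgCl 2) A) * (2 : PadicAlgCl 2) ^ N ! +
      (psNumer 2 N : PadicAlgCl 2) * aeval (r : PadicAlgCl 2) B = 0 := by
    have h1 : aeval r A * (2 : ℚ) ^ N ! + (psNumer 2 N : ℚ) * aeval r B = 0 := by
      unfold OnLevel at hpt
      field_simp at hpt
      linarith [hpt]
    have h2 := congrArg (Rat.cast : ℚ → PadicAlgCl 2) h1
    push_cast at h2
    rwa [aeval_ratCast, aeval_ratCast] at h2
  set a := A.natDegree
  set b := B.natDegree
  have he : a = gap A B + b := by simp only [gap]; omega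
  have hid : (2 : PadicAlgCl 2) ^ N ! * ((2 : PadicAlgCl 2) ^ (t * a) * aeval (r : PadicAlgCl 2) A) =
      -(psNumer 2 N : PadicAlgCl 2) * (2 : PadicAlgCl 2) ^ (t * gap A B) *
        ((2 : PadicAlgCl 2) ^ (t * b) * aeval (r : PadicAlgCl 2) B) := by
    rw [he, Nat.mul_add, pow_add]
    linear_combination (2 : PadicAlgCl 2) ^ (t * gap A B) * (2 : PadicAlgCl 2) ^ (t * b) * hK
  have hnA := norm_scaled_eval A hA0 ht1 hta
  have hnB := norm_scaled_eval B hB0 ht1 htb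
  have hp : ‖(psNumer 2 N : PadicAlgCl 2)‖ = 1 := by
    have := norm_intCast_of_odd (m := (psNumer 2 N : ℤ)) (by exact_mod_cast psNumer_two_odd hN)
    simpa using this
  have hnorm := congrArg norm hid
  rw [norm_mul, norm_pow, norm_two, hnA, norm_mul, norm_mul, norm_neg, hp, one_mul, norm_pow, norm_two, hnB,
    norm_intCast_padicAlgCl_two ha, norm_intCast_padicAlgCl_two hb, one_div, inv_pow, inv_pow,
    ← zpow_natCast, ← zpow_natCast, ← zpow_neg, ← zpow_neg, ← zpow_add₀ two_ne_zero,
    ← zpow_add₀ two_ne_zero] at hnorm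
  have hexp := zpow_right_injective₀ (by norm_num : (0 : ℝ) < 2) (by norm_num : (2 : ℝ) ≠ 1) hnorm
  simp only [kap]
  push_cast at hexp ⊢
  linarith

end Summit.Schanuel.Schanuel.Theorems.RootDecomp1KXLinear

end
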